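/-
Copyright: formalisation for the LaceExpansionHighD cell (what-if lane, kernel instance at `d := 10`).
Source formalised: R. Fitzner, R. van der Hofstad, *Mean-field behavior for nearest-neighbor percolation in d > 10*
(the NoBLE analysis), §5.1.2 (5.16) p. 1092 (the orbit sum `W_{n,j}`), Lemma 5.1 p. 1093 (monotonicity in the
dominance order), Rem. 5.1 p. 1090 (tabulated shell integrals), §5.3.3 p. 1098 (one representative per class).
-/
import Literature.Probability.FitznerVanDerHofstad2017.SrwOrbitPatternLaw
import Literature.Probability.FitznerVanDerHofstad2017.SrwIntegralTailDom
import Literature.Probability.FitznerVanDerHofstad2017.SrwKTUTablesD10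
import Literature.Probability.FitznerVanDerHofstad2017.SrwWSplitHybrid
import Literature.Probability.FitznerVanDerHofstad2017.SrwWSplitJensenKernel
import HarnessLib

/-!
# The collision-pattern evaluator of `W_{n,j}` with the monotone table lookup — kernel instance at `d := 10`

An INPUT-CERTIFICATION KERNEL (what-if lane): for a parts list `p` (the point `x = vecOfParts 10 p =
(p₀, …, p_{m-1}, 0, …, 0)`), `wPatQ n j p` evaluates the collision-pattern form of the orbit sum (5.16)
(`SrwOrbitPatternLaw.srwW_vecOfParts_le_pdSum`): every collision datum `δ ∈ enumPD m m` contributes its fibre weight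
`pdWeightL 10 m δ` times the MONOTONE TABLE LOOKUP `mluUpT` of its tail-count profile — the least cached value
`KTUD10.iUp n j c` over the 27 LANDED shell-class tables `c` (by name, `KTUD10.classesW`, `j ≤ c.jmax`) whose sorted
class point is dominated in the tail-count order by `y = x − κ_*(s·p)` (Lemma 5.1: then `I_{n,2j}(y) ≤ I_{n,2j}(x_c)`,
`SrwIntegralTailDom.srwI_le_of_absTailCount_le_upTo`), started at the origin value (`I ≤ I(0)`).

Main results: `srwW_le_wPatQ` (`W_{n,j}(vecOfParts 10 p) ≤ wPatQ n j p`, `1 ≤ n ≤ 4`, `j ≤ 22`, `|p| ≤ 10`), the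
chunkable table-check form `wPatLeTable` / `srwW_le_of_wPatLeTable`, the class-label bridge
`canonSite_eq_vecOfParts`, and the far value through the free split `K_{1,m'+j} ≤ √(I_{1,2m'}(0) W_{1,j})`
(`srwK_le_patFarQ`, on `SrwWSplitHybrid.srwK_le_of_srwW_cert` and `SrwWSplitJensenKernel.amgmNewton_spec`).
Pointer language only: nothing here is a statement about any dimension other than the kernel parameter, and a table
certified with this kernel is an input certificate, not a result of record.
-/

set_option Elab.async false

namespace Literature.Probability.FitznerVanDerHofstad2017

namespace WPatD10

open Finset KTUD10

/-! ### §1. Class data: tail counts and the sorted class point -/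

/-- Tail counts `#{μ : t ≤ |x_c,μ|}`, `t = 1, …, 6`, of the 27 tabulated classes. [folklore] -/
def ctails : C → List ℕ
  | .v0 => [0, 0, 0, 0, 0, 0]
  | .v1 => [1, 0, 0, 0, 0, 0]
  | .v2 => [2, 0, 0, 0, 0, 0]
  | .v3 => [3, 0, 0, 0, 0, 0]
  | .v4 => [4, 0, 0, 0, 0, 0]
  | .v01 => [1, 1, 0, 0, 0, 0]
  | .v11 => [2, 1, 0, 0, 0, 0]
  | .v001 => [1, 1, 1, 0, 0, 0]
  | .v02 => [2, 2, 0, 0, 0, 0]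
  | .v12 => [3, 2, 0, 0, 0, 0]
  | .v21 => [3, 1, 0, 0, 0, 0]
  | .v31 => [4, 1, 0, 0, 0, 0]
  | .v101 => [2, 1, 1, 0, 0, 0]
  | .v011 => [2, 2, 1, 0, 0, 0]
  | .v201 => [3, 1, 1, 0, 0, 0]
  | .v0001 => [1, 1, 1, 1, 0, 0]
  | .v1001 => [2, 1, 1, 1, 0, 0]
  | .v00001 => [1, 1, 1, 1, 1, 0]
  | .v6 => [6, 0, 0, 0, 0, 0]
  | .v41 => [5, 1, 0, 0, 0, 0]
  | .v22 => [4, 2, 0, 0, 0, 0]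
  | .v03 => [3, 3, 0, 0, 0, 0]
  | .v002 => [2, 2, 2, 0, 0, 0]
  | .v111 => [3, 2, 1, 0, 0, 0]
  | .v0101 => [2, 2, 1, 1, 0, 0]
  | .v2001 => [3, 1, 1, 1, 0, 0]
  | .v000001 => [1, 1, 1, 1, 1, 1]

/-- The class point sorted non-increasingly (`(2,1,1,0,…,0)` for `v21`). [folklore] -/
def cdesc (c : C) : Fin 10 → ℤ := fun k => c.coords.reverse.getD (k : ℕ) 0

/-- Per-class facts (kernel-decided): `cdesc c` is non-increasing, takes values in `[0, 6]`, has the absolute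
profile of `c.pt`, and its tail counts at `t = 1, …, 6` are `ctails c`. [folklore] -/
private theorem cdesc_facts (c : C) :
    (∀ a b : Fin 10, a ≤ b → cdesc c b ≤ cdesc c a) ∧ (∀ a : Fin 10, 0 ≤ cdesc c a) ∧
      (∀ a : Fin 10, cdesc c a ≤ 6) ∧ absProf (cdesc c) = absProf c.pt ∧
      ∀ k : ℕ, k < 6 → absTailCount (cdesc c) ((k : ℤ) + 1) = (ctails c).getD k 0 := by
  cases c <;> decide +kernel

/-- Equal absolute profiles give equal level-set counts. [folklore] -/
private theorem card_abs_eq_of_absProf_eq {z z' : Fin 10 → ℤ} (h : absProf z = absProf z') (v : ℤ) :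
    Fintype.card {μ // |z μ| = v} = Fintype.card {μ // |z' μ| = v} := by
  have key : ∀ w : Fin 10 → ℤ,
      Fintype.card {μ // |w μ| = v} = Multiset.card ((absProf w).filter (· = v)) := by
    intro w
    rw [Fintype.card_subtype, absProf, Multiset.filter_map, Multiset.card_map]
    rfl
  rw [key, key, h]

/-- `I_{n,l}(cdesc c) = I_{n,l}(x_c)` (a signed permutation apart). [cite: FitznerVanDerHofstad2016NoBLE, (3.35) p. 1071] -/
theorem srwI_cdesc (n l : ℕ) (c : C) : srwI 10 n l (cdesc c) = srwI 10 n l c.pt := by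
  obtain ⟨τ, hτ⟩ := exists_spAct_eq_of_card_abs_eq (cdesc c) c.pt
    (card_abs_eq_of_absProf_eq (cdesc_facts c).2.2.2.1)
  rw [← hτ, srwI_spAct]

/-! ### §2. Termwise domination of tail-count lists and the monotone table lookup -/

/-- `domL a b`: `a ≤ b` termwise (missing entries of `b` read as `0`). [folklore] -/
def domL : List ℕ → List ℕ → Bool
  | [], _ => true
  | a :: as, [] => (a == 0) && domL as []
  | a :: as, b :: bs => decide (a ≤ b) && domL as bs

/-- Semantics of `domL`. [folklore] -/
private theorem domL_getD : ∀ (a b : List ℕ), domL a b = true → ∀ k, a.getD k 0 ≤ b.getD k 0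
  | [], b, _, k => by simp
  | x :: xs, [], h, k => by
    simp only [domL, Bool.and_eq_true, beq_iff_eq] at h
    cases k with
    | zero => simp [h.1]
    | succ k => simpa using domL_getD xs [] h.2 k
  | x :: xs, y :: ys, h, k => by
    simp only [domL, Bool.and_eq_true, decide_eq_true_eq] at h
    cases k with
    | zero => simpa using h.1
    | succ k => simpa using domL_getD xs ys h.2 k

/-- The lookup table at `(n, j)`: tail counts and cached value of every class tabulated up to `j`
(`KTUD10.classesW`, `KTUD10.iUp`, by name). [cite: FitznerVanDerHofstad2016NoBLE, Rem. 5.1 p. 1090] -/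
def mluTable (n j : ℕ) : List (List ℕ × ℚ) :=
  (classesW.filter fun c => j ≤ c.jmax).map fun c => (ctails c, iUp n j c)

/-- One pass over the table keeping the least dominating value. [folklore] -/
def mluFold (tcs : List ℕ) : ℚ → List (List ℕ × ℚ) → ℚ
  | acc, [] => acc
  | acc, (ct, v) :: rest => mluFold tcs (if domL ct tcs && decide (v < acc) then v else acc) rest

/-- MONOTONE TABLE LOOKUP `mluUpT tab v0 tcs`: the least value among `v0` and the table entries whose class tail
counts are dominated termwise by `tcs`. [cite: FitznerVanDerHofstad2016NoBLE, Lemma 5.1 p. 1093; Rem. 5.1 p. 1090] -/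
def mluUpT (tab : List (List ℕ × ℚ)) (v0 : ℚ) (tcs : List ℕ) : ℚ := mluFold tcs v0 tab

/-- Invariant induction for `mluFold`. [folklore] -/
private theorem mluFold_induct (tcs : List ℕ) (P : ℚ → Prop) :
    ∀ (tab : List (List ℕ × ℚ)) (acc : ℚ), P acc →
      (∀ ctv ∈ tab, domL ctv.1 tcs = true → P ctv.2) → P (mluFold tcs acc tab)
  | [], acc, hacc, _ => hacc
  | (ct, v) :: rest, acc, hacc, htab => by
    unfold mluFold
    refine mluFold_induct tcs P rest _ ?_ fun ctv hmem => htab ctv (List.mem_cons_of_mem _ hmem)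
    split_ifs with h
    · simp only [Bool.and_eq_true, decide_eq_true_eq] at h
      exact htab (ct, v) List.mem_cons_self h.1
    · exact hacc

/-- **Soundness of the monotone table lookup**: if `tcs` lists the tail counts of `z` at `t = 1, …, 6`, then
`I_{n,2j}(z; 10) ≤ mluUpT (mluTable n j) (iUp n j v0) tcs` (`1 ≤ n ≤ 4`, `j ≤ 22`).
[cite: FitznerVanDerHofstad2016NoBLE, Lemma 5.1 p. 1093; Rem. 5.1 p. 1090] -/
theorem srwI_le_mluUpT {n : ℕ} (hn1 : 1 ≤ n) (hn : n ≤ 4) {j : ℕ} (hj : j ≤ 22) (z : Fin 10 → ℤ)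
    (tcs : List ℕ) (htcs : ∀ k < 6, tcs.getD k 0 = absTailCount z ((k : ℤ) + 1)) :
    srwI 10 n (2 * j) z ≤ ((mluUpT (mluTable n j) (iUp n j .v0) tcs : ℚ) : ℝ) := by
  have hd : 2 * n + 1 ≤ 10 := by omega
  refine mluFold_induct tcs (fun v => srwI 10 n (2 * j) z ≤ ((v : ℚ) : ℝ)) _ _
    (srwI_le_iUp_v0 hn1 hn hj z) ?_
  intro ctv hmem hdom
  simp only [mluTable, List.mem_map, List.mem_filter, decide_eq_true_eq] at hmem
  obtain ⟨c, ⟨_, hjc⟩, rfl⟩ := hmem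
  obtain ⟨hanti, h0, h6, _, htail⟩ := cdesc_facts c
  calc srwI 10 n (2 * j) z ≤ srwI 10 n (2 * j) (cdesc c) := by
        refine srwI_le_of_absTailCount_le_upTo hn1 hd (2 * j) z (cdesc c) (fun a b hab => hanti a b hab) h0 6 h6
          fun t ht1 ht6 => ?_
        obtain ⟨k, rfl⟩ : ∃ k : ℕ, t = (k : ℤ) + 1 := ⟨(t - 1).toNat, by omega⟩
        have hk : k < 6 := by omega
        rw [htail k hk, ← htcs k hk]
        exact domL_getD _ _ hdom k
    _ = srwI 10 n (2 * j) c.pt := srwI_cdesc n (2 * j) c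
    _ ≤ ((iUp n j c : ℚ) : ℝ) := iUp_valid c n hn j hjc

/-- The lookup value is non-negative (`1 ≤ n ≤ 4`, `j ≤ 22`). [folklore] -/
private theorem mluUpT_nonneg {n : ℕ} (hn1 : 1 ≤ n) (hn : n ≤ 4) {j : ℕ} (hj : j ≤ 22) (tcs : List ℕ) :
    (0 : ℝ) ≤ ((mluUpT (mluTable n j) (iUp n j .v0) tcs : ℚ) : ℝ) := by
  have hd : 2 * n + 1 ≤ 10 := by omega
  refine mluFold_induct tcs (fun v => (0 : ℝ) ≤ ((v : ℚ) : ℝ)) _ _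
    ((srwI_nonneg n hd _ _).trans (srwI_le_iUp_v0 hn1 hn hj 0)) ?_
  intro ctv hmem _
  simp only [mluTable, List.mem_map, List.mem_filter, decide_eq_true_eq] at hmem
  obtain ⟨c, ⟨_, hjc⟩, rfl⟩ := hmem
  exact (srwI_nonneg n hd _ _).trans (iUp_valid c n hn j hjc)

/-! ### §3. The pattern evaluator `wPatQ` and its soundness -/

/-- Contribution of one collision datum: fibre weight × table lookup of its tail-count profile (evaluation order
forced). [cite: FitznerVanDerHofstad2016NoBLE, (5.16) p. 1092] -/
def wTerm (tab : List (List ℕ × ℚ)) (v0 : ℚ) (p : List ℕ) (δ : List (Option (Fin p.length × Bool))) : ℚ :=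
  seqListNat (pdProfile p δ) fun prof =>
    seqListNat (tailsUpTo 6 prof) fun tcs => (pdWeightL 10 p.length δ : ℚ) * mluUpT tab v0 tcs

/-- Sum of `wTerm` over a list of data. [cite: FitznerVanDerHofstad2016NoBLE, (5.16) p. 1092] -/
def wPatSumT (tab : List (List ℕ × ℚ)) (v0 : ℚ) (p : List ℕ)
    (ds : List (List (Option (Fin p.length × Bool)))) : ℚ :=
  (ds.map (wTerm tab v0 p)).sum

/-- THE PATTERN EVALUATOR `wPatQ n j p ≥ W_{n,j}(vecOfParts 10 p; 10)`: the collision-pattern form of (5.16) with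
every shell integral replaced by the monotone table lookup. [cite: FitznerVanDerHofstad2016NoBLE, (5.16) p. 1092] -/
def wPatQ (n j : ℕ) (p : List ℕ) : ℚ :=
  wPatSumT (mluTable n j) (iUp n j .v0) p (enumPD p.length p.length) /
    ((Nat.descFactorial 10 p.length : ℚ) * 2 ^ p.length)

/-- The cast of the pattern sum, termwise. [folklore] -/
private theorem cast_wPatSumT (tab : List (List ℕ × ℚ)) (v0 : ℚ) (p : List ℕ)
    (ds : List (List (Option (Fin p.length × Bool)))) :
    ((wPatSumT tab v0 p ds : ℚ) : ℝ) =
      (ds.map fun δ => (pdWeightL 10 p.length δ : ℝ) *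
        ((mluUpT tab v0 (tailsUpTo 6 (pdProfile p δ)) : ℚ) : ℝ)).sum := by
  induction ds with
  | nil => simp [wPatSumT]
  | cons δ rest ih =>
    unfold wPatSumT at ih ⊢
    rw [List.map_cons, List.sum_cons, Rat.cast_add, ih, List.map_cons, List.sum_cons]
    congr 1
    simp only [wTerm, seqListNat_eq]
    push_cast
    rfl

/-- **Soundness of the pattern evaluator**: `W_{n,j}(vecOfParts 10 p; 10) ≤ wPatQ n j p` for `1 ≤ n ≤ 4`, `j ≤ 22`,
`|p| ≤ 10`. [cite: FitznerVanDerHofstad2016NoBLE, (5.16) p. 1092; Lemma 5.1 p. 1093] -/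
theorem srwW_le_wPatQ {n : ℕ} (hn1 : 1 ≤ n) (hn : n ≤ 4) {j : ℕ} (hj : j ≤ 22) (p : List ℕ)
    (hp : p.length ≤ 10) : srwW 10 n j (vecOfParts 10 p) ≤ ((wPatQ n j p : ℚ) : ℝ) := by
  have hd : 2 * n + 1 ≤ 10 := by omega
  let g : List (Option (Fin p.length × Bool)) → ℝ := fun δ =>
    ((mluUpT (mluTable n j) (iUp n j .v0) (tailsUpTo 6 (pdProfile p δ)) : ℚ) : ℝ)
  have hg0 : ∀ δ, 0 ≤ g δ := fun δ => mluUpT_nonneg hn1 hn hj _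
  have hg : ∀ (κ : Fin p.length ↪ Fin 10) (s : Fin p.length → ℤˣ),
      srwI 10 n (2 * j) (vecOfParts 10 p - sgnInjVec κ s fun i => (p.get i : ℤ)) ≤ g (pdatumL κ s) :=
    fun κ s => srwI_le_mluUpT hn1 hn hj _ _ fun k hk => by
      rw [getD_tailsUpTo 6 _ k hk, ← card_filter_le_abs_vecOfParts_sub_sgnInjVec p hp κ s (k + 1) (by omega)]
      unfold absTailCount
      push_cast
      rfl
  refine (srwW_vecOfParts_le_pdSum hd j p hp g hg0 hg).trans (le_of_eq ?_)
  rw [wPatQ, Rat.cast_div, cast_wPatSumT]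
  push_cast
  rfl

/-! ### §4. Table-check form (chunkable) -/

/-- `wPatLeTable n w rows`: every row `(j, p)` has `wPatQ n j p ≤ w j p` (a `Bool`; one `decide +kernel` per chunk
of rows). [cite: FitznerVanDerHofstad2016NoBLE, (5.16) p. 1092; §5.3.3 p. 1098] -/
def wPatLeTable (n : ℕ) (w : ℕ → List ℕ → ℚ) (rows : List (ℕ × List ℕ)) : Bool :=
  rows.all fun r => decide (wPatQ n r.1 r.2 ≤ w r.1 r.2)

/-- Chunking a table check. [cite: FitznerVanDerHofstad2016NoBLE, §5.3.3 p. 1098] -/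
theorem wPatLeTable_of_take_drop {n : ℕ} {w : ℕ → List ℕ → ℚ} {rows : List (ℕ × List ℕ)} (k : ℕ)
    (h₁ : wPatLeTable n w (rows.take k) = true) (h₂ : wPatLeTable n w (rows.drop k) = true) :
    wPatLeTable n w rows = true := by
  rw [← List.take_append_drop k rows]
  unfold wPatLeTable at *
  rw [List.all_append, h₁, h₂]; rfl

/-- Concatenating table checks. [cite: FitznerVanDerHofstad2016NoBLE, §5.3.3 p. 1098] -/
theorem wPatLeTable_append {n : ℕ} {w : ℕ → List ℕ → ℚ} {r₁ r₂ : List (ℕ × List ℕ)}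
    (h₁ : wPatLeTable n w r₁ = true) (h₂ : wPatLeTable n w r₂ = true) : wPatLeTable n w (r₁ ++ r₂) = true := by
  unfold wPatLeTable at *
  rw [List.all_append, h₁, h₂]; rfl

/-- Consing a certified row onto a certified table. [cite: FitznerVanDerHofstad2016NoBLE, §5.3.3 p. 1098] -/
theorem wPatLeTable_cons {n : ℕ} {w : ℕ → List ℕ → ℚ} {r : ℕ × List ℕ} {rs : List (ℕ × List ℕ)}
    (h₁ : wPatLeTable n w [r] = true) (h₂ : wPatLeTable n w rs = true) : wPatLeTable n w (r :: rs) = true :=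
  wPatLeTable_append (r₁ := [r]) h₁ h₂

/-- A certified table dominates `W_{n,j}(vecOfParts 10 p)` on its rows (`1 ≤ n ≤ 4`; rows with `j ≤ 22`, `|p| ≤ 10`).
[cite: FitznerVanDerHofstad2016NoBLE, (5.16) p. 1092] -/
theorem srwW_le_of_wPatLeTable {n : ℕ} (hn1 : 1 ≤ n) (hn : n ≤ 4) {w : ℕ → List ℕ → ℚ}
    {rows : List (ℕ × List ℕ)} (h : wPatLeTable n w rows = true) :
    ∀ r ∈ rows, r.1 ≤ 22 → r.2.length ≤ 10 → srwW 10 n r.1 (vecOfParts 10 r.2) ≤ ((w r.1 r.2 : ℚ) : ℝ) := by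
  intro r hr hj hp
  unfold wPatLeTable at h
  have h' := (List.all_eq_true.1 h) r hr
  simp only [decide_eq_true_eq] at h'
  exact (srwW_le_wPatQ hn1 hn hj r.2 hp).trans (by exact_mod_cast h')

/-! ### §5. Class labels and the far value through the free split -/

/-- The parts list of a class label `l` (multiplicity list): the ascending coordinate list `coordList 1 l` read in `ℕ`
(`partsOf [3, 1] = [1, 1, 1, 2]`). [folklore] -/
def partsOf (l : List ℕ) : List ℕ := (coordList 1 l).map Int.toNat

/-- Entries of `coordList w l` are at least `w`. [folklore] -/
private theorem le_of_mem_coordList : ∀ (w : ℕ) (l : List ℕ), ∀ x ∈ coordList w l, (w : ℤ) ≤ x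
  | w, [], x, hx => by simp [coordList] at hx
  | w, a :: t, x, hx => by
    simp only [coordList, List.mem_append, List.mem_replicate] at hx
    rcases hx with ⟨_, rfl⟩ | hx
    · exact le_rfl
    · have := le_of_mem_coordList (w + 1) t x hx
      push_cast at this
      omega

/-- **The class-label bridge**: the canonical point of `l` is the zero-padding of `partsOf l`.
[cite: FitznerVanDerHofstad2016NoBLE, §5.3.3 p. 1098] -/
theorem canonSite_eq_vecOfParts (d : ℕ) (l : List ℕ) : canonSite d l = vecOfParts d (partsOf l) := by
  funext μ
  simp only [canonSite, vecOfParts, partsOf, List.getD_eq_getElem?_getD, List.getElem?_map]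
  rcases h : (coordList 1 l)[(μ : ℕ)]? with _ | x
  · simp
  · have hx : (1 : ℤ) ≤ x := by
      have := le_of_mem_coordList 1 l x (List.mem_of_getElem? h)
      exact_mod_cast this
    simp only [Option.map_some, Option.getD_some]
    omega

/-- `|coordList w l| = Σ l`. [folklore] -/
private theorem length_coordList' : ∀ (w : ℕ) (l : List ℕ), (coordList w l).length = l.sum
  | w, [] => by simp [coordList]
  | w, a :: t => by
    simp only [coordList, List.length_append, List.length_replicate, List.sum_cons, length_coordList' (w + 1) t]

/-- `|partsOf l| = Σ l` (the class label lists multiplicities; its canonical point has `Σ l` non-zero coordinates).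
[cite: FitznerVanDerHofstad2016NoBLE, §5.3.3 p. 1098] -/
theorem length_partsOf (l : List ℕ) : (partsOf l).length = l.sum := by
  rw [partsOf, List.length_map, length_coordList']

/-- The far value through the free split: the Newton value of `A = iUp 1 m' v0 ≥ I_{1,2m'}(0)` and a `W`-bound `B`.
[cite: FitznerVanDerHofstad2016NoBLE, §5.1.2 (5.16) p. 1092] -/
def patFarQ (m' : ℕ) (B : ℚ) : ℚ := amgmNewton (iUp 1 m' .v0) B

/-- **`K_{1,m'+j}(x; 10) ≤ patFarQ m' B`** whenever `W_{1,j}(x; 10) ≤ B` and `m' ≤ 22` — Cauchy–Schwarz across the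
free split `m' + j` (`srwK_le_of_srwW_cert`) with the landed origin table and the Newton surrogate of the geometric
mean. [cite: FitznerVanDerHofstad2016NoBLE, §5.1.2 (5.16) p. 1092] -/
theorem srwK_le_patFarQ {m' j : ℕ} (hm' : m' ≤ 22) {x : Fin 10 → ℤ} {B : ℚ} (hB : srwW 10 1 j x ≤ ((B : ℚ) : ℝ)) :
    srwK 10 1 (m' + j) x ≤ ((patFarQ m' B : ℚ) : ℝ) := by
  have hA : srwI 10 1 (2 * m') 0 ≤ ((iUp 1 m' .v0 : ℚ) : ℝ) := srwI_le_iUp_v0 le_rfl (by norm_num) hm' 0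
  have hA0 : (0 : ℝ) ≤ ((iUp 1 m' .v0 : ℚ) : ℝ) := (srwI_zero_even_nonneg 1 m').trans hA
  have hB0 : (0 : ℝ) ≤ ((B : ℚ) : ℝ) := (srwW_nonneg 1 j x).trans hB
  obtain ⟨hF, hAB⟩ := amgmNewton_spec hA0 hB0
  rw [patFarQ, amgmNewton]
  push_cast
  exact srwK_le_of_srwW_cert (n := 1) (by norm_num) hA hB hF hAB

/-- **Far value of a class label from a certified `W`-table row**: for a class label `l` with `Σ l ≤ 10` and a row
`(j, partsOf l)` of a certified table (`j ≤ 22`), `K_{1,m'+j}(canonSite 10 l) ≤ patFarQ m' (w j (partsOf l))`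
(`m' ≤ 22`). [cite: FitznerVanDerHofstad2016NoBLE, §5.1.2 (5.16) p. 1092; §5.3.3 p. 1098] -/
theorem srwK_canonSite_le_patFarQ_of_wPatLeTable {w : ℕ → List ℕ → ℚ} {rows : List (ℕ × List ℕ)}
    (h : wPatLeTable 1 w rows = true) {l : List ℕ} (hl : l.sum ≤ 10) {j : ℕ} (hj : j ≤ 22)
    (hrow : (j, partsOf l) ∈ rows) {m' : ℕ} (hm' : m' ≤ 22) :
    srwK 10 1 (m' + j) (canonSite 10 l) ≤ ((patFarQ m' (w j (partsOf l)) : ℚ) : ℝ) := by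
  rw [canonSite_eq_vecOfParts]
  exact srwK_le_patFarQ hm'
    (srwW_le_of_wPatLeTable le_rfl (by norm_num) h (j, partsOf l) hrow hj (by rw [length_partsOf]; exact hl))

end WPatD10

end Literature.Probability.FitznerVanDerHofstad2017
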